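import Mathlib
import Summits.ValiantsHypothesis.ValiantsHypothesis.Theorems.BarrierLeverTransversalMinorLayoutsCompressionBase

/-!
# Route BarrierLever — conjecture TT (`TransversalMinorLayoutsNonsingular`, stmt-ValiantsHypothesis-19152):
# compound-minor pairings, part 2 — the COMPRESSION CRITERION (free moves)

Notation as in part 1 (`…CompressionBase`): `P_g[j, i] := det (g.submatrix (F j) (F' i))`,
`(F, F')` is *good* iff `det P_g ≠ 0` for some `g`; TT(u, w) = goodness of `(ρ ∘ u, τ ∘ w)`.

* `pairing_good_of_compression` (FREE MOVE): let `G` arise from `F` by the classical COMPRESSION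
  (shift) `n → m` of set systems — the members containing `n` and not `m` whose shifted copy is
  not already a member (up to reordering) get `n` replaced by `m`, all other members are kept.
  If `(G, F')` is good then `(F, F')` is good.  *Proof.* Row operation `row n += t · row m` on
  `g`; every entry of `P` becomes affine in `t` (`submatrix_rowop_det`); by multilinearity
  `det P_{g_t} = Σ_s t^{|s|} D_s` (`det_rows_add_smul`); were `(F, F')` bad, this polynomial in
  `t` would vanish identically and so would its `t^{|A|}`-coefficient (`A` = the moved members);
  every `s ≠ A` with `|s| = |A|` contains an unmoved `j ∈ s` which is ineligible (zero row), or
  contains `m` (its shifted minor repeats a row), or is blocked (its shifted copy is a member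
  `j'`: rows `j, j'` proportional) — so `D_s = 0`, and `D_A = det P^{G}_g = 0` for every `g`.
* `pairing_good_of_compression'`: the same move on the second family (by `pairing_good_comm`).

CONSEQUENCE (the criterion; base case `pairing_good_of_iso` in part 1): TT(u, w) holds whenever
the transversal families `ρ ∘ u`, `τ ∘ w` have ISOMORPHIC COMPRESSION-DESCENDANTS — chains of
free moves on either side, through arbitrary (also non-transversal) families, ending in isomorphic
families.  Representation-theoretically `(F, F')` is good iff `e_{F'} ̸⊥ U(gl) · e_F` in
`Λ^r Λ^h ℂ^ι`, and `E_{mn}^{(k)} e_F = ± e_{C F}` for the compression `C`; shifted descendants are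
highest-weight vectors (exterior shifting).  EVIDENCE (seat folder scripts/, work/*.log, kit
j250873–j250875): every pair of transversal `r`-families has a common descendant for `h ≤ 3`
(exhaustive; for `h = 3` and each `r < 8` even a UNIVERSAL descendant, e.g. `r = 4`:
`{012, 013, 014, 023}`), and at `h = 4` the 3-subcube versus all 73 other 8-families.

WHAT THIS IS NOT: not a proof of TT / TNS / item 19717 — the combinatorial statement «any two
transversal `r`-families have isomorphic compression-descendants» is OPEN (verified `h ≤ 3`,
sampled `h = 4`); nothing here bears on crux 14610 or on VP versus VNP.

References: G. Kalai, *Algebraic shifting* (Adv. Stud. Pure Math. 33, 2002) — shifted families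
as extremal vectors of exterior powers; N. Nisan, STOC 1991; [ForbesShpilkaVolk2018] §8 / Q. 6.
-/

-- layout Summits/ValiantsHypothesis/ValiantsHypothesis forces the duplicated namespace component
set_option linter.dupNamespace false

open Matrix Finset

namespace Summit.ValiantsHypothesis.ValiantsHypothesis.Theorems.BarrierLever.Compression

variable {κ α ι : Type*} [Fintype κ] [DecidableEq κ] [Fintype α] [DecidableEq α]
  [Fintype ι] [DecidableEq ι]

/-! ## 3. The free move: compressions -/

omit [Fintype κ] [DecidableEq κ] [Fintype ι] in
/-- Row operation `row n += t • row m` on `g`, seen on a minor whose row tuple is injective: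
the minor becomes `minor + t • (minor with the symbol n replaced by m)` (or is unchanged when the
row tuple misses `n`). -/
theorem submatrix_rowop_det (F : κ → α → ι) (n m : ι) (g : Matrix ι ι ℂ) (t : ℂ) (j : κ)
    (C : α → ι) (hF : Function.Injective (F j)) :
    ((g + t • Matrix.of fun x y => if x = n then g m y else 0).submatrix (F j) C).det =
      (g.submatrix (F j) C).det +
        t * (if ∃ b, F j b = n then
              (g.submatrix (fun b => if F j b = n then m else F j b) C).det else 0) := by
  classical
  by_cases hex : ∃ b, F j b = n
  · obtain ⟨b₀, hb₀⟩ := hex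
    rw [if_pos ⟨b₀, hb₀⟩]
    have hrow : (g + t • Matrix.of fun x y => if x = n then g m y else 0).submatrix (F j) C =
        (g.submatrix (F j) C).updateRow b₀
          ((g.submatrix (F j) C) b₀ + t • fun c => g m (C c)) := by
      ext a c
      simp only [submatrix_apply, Matrix.add_apply, Matrix.smul_apply, of_apply, smul_eq_mul,
        updateRow_apply]
      by_cases ha : a = b₀
      · subst ha
        simp [hb₀, submatrix_apply]
      · have : F j a ≠ n := fun e => ha (hF (e.trans hb₀.symm))
        simp [ha, this]
    have hmv : (g.submatrix (fun b => if F j b = n then m else F j b) C) =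
        (g.submatrix (F j) C).updateRow b₀ (fun c => g m (C c)) := by
      ext a c
      simp only [submatrix_apply, updateRow_apply]
      by_cases ha : a = b₀
      · subst ha; simp [hb₀]
      · have : F j a ≠ n := fun e => ha (hF (e.trans hb₀.symm))
        simp [ha, this]
    rw [hrow, det_updateRow_add, updateRow_eq_self, det_updateRow_smul, hmv]
  · rw [if_neg hex, mul_zero, add_zero]
    congr 1
    ext a c
    have : F j a ≠ n := fun e => hex ⟨a, e⟩
    simp [submatrix_apply, this]

omit [DecidableEq κ] in
/-- Multilinear expansion of a determinant whose rows are `v j + t • w j`: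
`det = Σ_s t^{|s|} · det (rows w on s, rows v off s)`. -/
theorem det_rows_add_smul [DecidableEq κ] (v w : κ → κ → ℂ) (t : ℂ) :
    (Matrix.of fun j i => v j i + t * w j i).det =
      ∑ s : Finset κ, t ^ s.card * (Matrix.of fun j i => if j ∈ s then w j i else v j i).det := by
  classical
  have h1 : (Matrix.of fun j i => v j i + t * w j i) = (fun j => t • w j) + v := by
    ext j i; simp [add_comm]
  have h2 := (Matrix.detRowAlternating : (κ → ℂ) [⋀^κ]→ₗ[ℂ] ℂ).toMultilinearMap.map_add_univ
    (fun j => t • w j) v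
  have h2' : Matrix.det (((fun j => t • w j) + v : κ → κ → ℂ)) =
      ∑ s : Finset κ, Matrix.det (s.piecewise (fun j => t • w j) v) := h2
  rw [h1, h2']
  refine Finset.sum_congr rfl fun s _ => ?_
  have h3 : s.piecewise (fun j => t • w j) v =
      Matrix.of fun j i => (if j ∈ s then t else 1) * (if j ∈ s then w j i else v j i) := by
    ext j i
    by_cases hj : j ∈ s
    · rw [Finset.piecewise_eq_of_mem _ _ _ hj]
      simp only [Pi.smul_apply, smul_eq_mul, of_apply, if_pos hj]
    · rw [Finset.piecewise_eq_of_notMem _ _ _ hj]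
      simp only [of_apply, if_neg hj, one_mul]
  rw [h3, det_mul_column]
  congr 1
  rw [Finset.prod_ite_mem, Finset.univ_inter, Finset.prod_const]

omit [Fintype ι] in
/-- FREE MOVE (compression `n → m` on the first family).  Hypotheses: the members of `F` are
injective tuples; `A` is the set of MOVED members — each contains `n` and not `m`, and `G`
replaces `n` by `m` there; off `A`, `G = F`; and every unmoved member containing `n` and not `m`
is BLOCKED: its shifted copy is (a reordering of) some member of `F`.  Then goodness of `(G, F')`
implies goodness of `(F, F')`. -/
theorem pairing_good_of_compression (F G F' : κ → α → ι) (n m : ι) (hnm : n ≠ m)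
    (A : Finset κ)
    (hF : ∀ j, Function.Injective (F j))
    (hA : ∀ j ∈ A, (∃ b, F j b = n) ∧ ∀ b, F j b ≠ m)
    (hGA : ∀ j ∈ A, ∀ b, G j b = if F j b = n then m else F j b)
    (hGnA : ∀ j ∉ A, G j = F j)
    (hblock : ∀ j ∉ A, (∃ b, F j b = n) → (∀ b, F j b ≠ m) →
      ∃ j', ∃ τ : Equiv.Perm α, ∀ b, F j' b = if F j (τ b) = n then m else F j (τ b))
    (hG : ∃ g : Matrix ι ι ℂ, (Matrix.of fun j i => (g.submatrix (G j) (F' i)).det).det ≠ 0) :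
    ∃ g : Matrix ι ι ℂ, (Matrix.of fun j i => (g.submatrix (F j) (F' i)).det).det ≠ 0 := by
  classical
  by_contra hbad
  push Not at hbad
  obtain ⟨g, hg⟩ := hG
  apply hg
  -- the unperturbed rows `v`, the shifted rows `w`, and the mixed determinants `D`
  obtain ⟨v, hv⟩ : ∃ v : κ → κ → ℂ, v = fun j i => (g.submatrix (F j) (F' i)).det := ⟨_, rfl⟩
  obtain ⟨w, hw⟩ : ∃ w : κ → κ → ℂ, w = fun j i =>
      if ∃ b, F j b = n then
        (g.submatrix (fun b => if F j b = n then m else F j b) (F' i)).det else 0 := ⟨_, rfl⟩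
  obtain ⟨D, hD⟩ : ∃ D : Finset κ → ℂ,
      D = fun s => (Matrix.of fun j i => if j ∈ s then w j i else v j i).det := ⟨_, rfl⟩
  -- (1) for every t the pairing determinant of g_t vanishes, and it expands multilinearly
  have hexp : ∀ t : ℂ, ∑ s : Finset κ, t ^ s.card * D s = 0 := by
    intro t
    have h0 := hbad (g + t • Matrix.of fun x y => if x = n then g m y else 0)
    have h1 : (Matrix.of fun j i =>
        ((g + t • Matrix.of fun x y => if x = n then g m y else 0).submatrix (F j) (F' i)).det) =
        Matrix.of fun j i => v j i + t * w j i := by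
      ext j i
      simp only [of_apply]
      rw [submatrix_rowop_det F n m g t j (F' i) (hF j), hv, hw]
    rw [h1, det_rows_add_smul] at h0
    rw [hD]
    exact h0
  -- (2) hence the coefficient of t ^ |A| vanishes
  obtain ⟨p, hp⟩ : ∃ p : Polynomial ℂ,
      p = ∑ s : Finset κ, Polynomial.C (D s) * Polynomial.X ^ s.card := ⟨_, rfl⟩
  have hp0 : p = 0 := by
    apply Polynomial.funext
    intro t
    rw [Polynomial.eval_zero, hp, Polynomial.eval_finsetSum, ← hexp t]
    refine Finset.sum_congr rfl fun s _ => ?_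
    rw [Polynomial.eval_mul, Polynomial.eval_C, Polynomial.eval_pow, Polynomial.eval_X, mul_comm]
  have hDs : ∀ s : Finset κ, s ≠ A → s.card = A.card → D s = 0 := by
    intro s hs hc
    have hnot : ¬ s ⊆ A := fun hsub => hs (Finset.eq_of_subset_of_card_le hsub hc.ge)
    obtain ⟨j, hjs, hjA⟩ := Finset.not_subset.mp hnot
    rw [hD]
    simp only
    by_cases hel : ∃ b, F j b = n
    · by_cases hm : ∀ b, F j b ≠ m
      · -- `j` is blocked by some member `j'`
        obtain ⟨j', τ, hj'⟩ := hblock j hjA hel hm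
        obtain ⟨b₀, hb₀⟩ := hel
        have hjj' : j' ≠ j := by
          intro e
          apply hm ((Equiv.symm τ) b₀)
          have h' := hj' ((Equiv.symm τ) b₀)
          rw [e] at h'
          rw [h']
          simp [hb₀]
        have hj'n : ¬ ∃ b, F j' b = n := by
          rintro ⟨b, hb⟩
          rw [hj' b] at hb
          by_cases h' : F j (τ b) = n
          · rw [if_pos h'] at hb; exact hnm hb.symm
          · rw [if_neg h'] at hb; exact h' hb
        by_cases hj's : j' ∈ s
        · -- row `j'` is a shifted row of an ineligible member: zero
          refine det_eq_zero_of_row_eq_zero j' fun i => ?_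
          simp only [of_apply, if_pos hj's, hw, hj'n, if_false]
        · -- rows `j'` and `j` are proportional
          have hrowj : ∀ i, (Matrix.of fun j i => if j ∈ s then w j i else v j i) j i =
              (g.submatrix (fun b => if F j b = n then m else F j b) (F' i)).det := by
            intro i
            have hel' : ∃ b, F j b = n := ⟨b₀, hb₀⟩
            simp only [of_apply, if_pos hjs, hw, hel', if_true]
          have hrowj' : ∀ i, (Matrix.of fun j i => if j ∈ s then w j i else v j i) j' i =
              ((Equiv.Perm.sign τ : ℤ) : ℂ) *
                (Matrix.of fun j i => if j ∈ s then w j i else v j i) j i := by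
            intro i
            rw [hrowj i]
            simp only [of_apply, if_neg hj's, hv]
            have hsub : g.submatrix (F j') (F' i) =
                (g.submatrix (fun b => if F j b = n then m else F j b) (F' i)).submatrix τ id := by
              ext a c
              simp only [submatrix_apply, id, hj' a]
            rw [hsub, det_permute]
          have hupd : (Matrix.of fun j i => if j ∈ s then w j i else v j i) =
              (Matrix.of fun j i => if j ∈ s then w j i else v j i).updateRow j'
                (((Equiv.Perm.sign τ : ℤ) : ℂ) •
                  (Matrix.of fun j i => if j ∈ s then w j i else v j i) j) := by
            ext x i
            by_cases hx : x = j'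
            · subst hx
              rw [updateRow_self, Pi.smul_apply, smul_eq_mul, hrowj' i]
            · rw [updateRow_ne hx]
          rw [hupd, det_updateRow_smul]
          refine mul_eq_zero_of_right _ ?_
          refine det_zero_of_row_eq hjj' ?_
          ext i
          rw [updateRow_self, updateRow_ne (Ne.symm hjj')]
      · -- `j` contains both `n` and `m`: its shifted minor has two equal rows
        push Not at hm
        obtain ⟨b₁, hb₁⟩ := hm
        obtain ⟨b₀, hb₀⟩ := hel
        have hb01 : b₀ ≠ b₁ := by
          intro e; subst e; exact hnm (hb₀.symm.trans hb₁)
        have hel' : ∃ b, F j b = n := ⟨b₀, hb₀⟩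
        refine det_eq_zero_of_row_eq_zero j fun i => ?_
        simp only [of_apply, if_pos hjs, hw, hel', if_true]
        refine det_zero_of_row_eq hb01 ?_
        ext c
        simp only [submatrix_apply, hb₀, if_true, hb₁, if_neg (Ne.symm hnm)]
    · -- `j` is not eligible: zero row
      refine det_eq_zero_of_row_eq_zero j fun i => ?_
      simp only [of_apply, if_pos hjs, hw, hel, if_false]
  have hcoeff : p.coeff A.card = D A := by
    rw [hp, Polynomial.finsetSum_coeff, Finset.sum_eq_single A]
    · rw [Polynomial.coeff_C_mul_X_pow, if_pos rfl]
    · intro s _ hs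
      rw [Polynomial.coeff_C_mul_X_pow]
      by_cases hc : A.card = s.card
      · rw [if_pos hc, hDs s hs hc.symm]
      · rw [if_neg hc]
    · intro hA'; exact absurd (Finset.mem_univ A) hA'
  have hDA : D A = 0 := by
    rw [← hcoeff, hp0, Polynomial.coeff_zero]
  -- (3) `D A` is the pairing determinant of `G`
  rw [← hDA, hD]
  simp only
  congr 1
  ext j i
  simp only [of_apply]
  by_cases hj : j ∈ A
  · have hel : ∃ b, F j b = n := (hA j hj).1
    simp only [if_pos hj, hw, hel, if_true]
    congr 1
    ext a c
    simp only [submatrix_apply, hGA j hj a]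
  · rw [if_neg hj, hv, hGnA j hj]

omit [Fintype ι] in
/-- FREE MOVE on the second family (by symmetry). -/
theorem pairing_good_of_compression' (F F' G' : κ → α → ι) (n m : ι) (hnm : n ≠ m)
    (A : Finset κ)
    (hF' : ∀ i, Function.Injective (F' i))
    (hA : ∀ i ∈ A, (∃ b, F' i b = n) ∧ ∀ b, F' i b ≠ m)
    (hGA : ∀ i ∈ A, ∀ b, G' i b = if F' i b = n then m else F' i b)
    (hGnA : ∀ i ∉ A, G' i = F' i)
    (hblock : ∀ i ∉ A, (∃ b, F' i b = n) → (∀ b, F' i b ≠ m) →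
      ∃ i', ∃ τ : Equiv.Perm α, ∀ b, F' i' b = if F' i (τ b) = n then m else F' i (τ b))
    (hG : ∃ g : Matrix ι ι ℂ, (Matrix.of fun j i => (g.submatrix (F j) (G' i)).det).det ≠ 0) :
    ∃ g : Matrix ι ι ℂ, (Matrix.of fun j i => (g.submatrix (F j) (F' i)).det).det ≠ 0 := by
  rw [pairing_good_comm] at hG ⊢
  exact pairing_good_of_compression F' G' F n m hnm A hF' hA hGA hGnA hblock hG

end Summit.ValiantsHypothesis.ValiantsHypothesis.Theorems.BarrierLever.Compression
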